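import Summits.BirchSwinnertonDyer.BirchSwinnertonDyer.Theorems.ThetaPartnerAtTwoSignedKatoUpToAtTwoKatoValueTransferPadic
import Summits.BirchSwinnertonDyer.BirchSwinnertonDyer.Theorems.ThetaPartnerAtTwoSignedKatoUpToAtTwoEqualModulusTransport
import Summits.BirchSwinnertonDyer.BirchSwinnertonDyer.Theorems.ThetaPartnerAtTwoSignedKatoUpToAtTwoKatoTrivialCharValues
import HarnessLib

/-!
# Route `ThetaPartnerAtTwo` (TP2), crux K3 `SignedKatoDivisibilityUpToAtTwo` (stmt-BirchSwinnertonDyer-20308 / K3P′ 25631), line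
# `colemanrat` v13 — Kato's values AT `p = 2` IN THE SOCKET'S CURRENCY: modulus `2^k`, `ℚ̄₂`-valued characters, the Galois family `τ_b`
# modulo `2^k` (bricks B2/B4c pushed along `e : ℚ(ζ_{2^k}) → ℚ̄₂` and across `cycLevel 2 k ∅ = 2^k`)

Width seat `bsd-wall-tp2-p2x-w4` g0 (cell `bsd-wall`). HONEST FRAMING: theorems only (no definition, no named fact, no instance, no `sorry`);
CONDITIONAL on a `ZetaBody` witness (the conclusion of the cite-only fact `Kato2004.exists_eulerSystem_expStar_values`); closes no item;
K3 / K3P′ are NOT settled and BSD is NOT proved by any of this.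

## What

The lead's B5a (`KatoBK.sum_pow_mul_trace_eq_mul`) and the socket CORE_χ^prim work modulo `2^(n+2)` with `ℚ̄₂`-valued characters and a
family `τ : ZMod (2^(n+2)) → Γ_{ℚ₂}`; Kato's side (`KatoValue.charSum_smul_mul_gaussSum_eq_padic`, `KatoValue.sum_sigma_eq_of_zetaBody`) is
typed at `cycLevel 2 k ∅`. This file performs the one transport (`KatoValue.cycLevel_empty_eq`, the equal-modulus kit) and the descent
`ℚ̄₂ → ℚ(ζ)` (`exists_ringHomComp_eq_two`), delivering turnkey statements:

* **`charSum_smul_mul_gaussSum_eq_two`**: for `ZetaBody W 2 f ι κ Λ c d a A z x`, `κ = q`, `A = 2^e`, `k ≥ 1`, guards, `ι`-normalisation at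
  level `cycLevel 2 k ∅`, `e : CyclotomicField (cycLevel 2 k ∅) ℚ →+* ℚ̄₂` with `e ζ = zeta 2 k`, `τ : ZMod (2^k) → Γ_{ℚ₂}` with `τ_b ζ_{2^k} = ζ_{2^k}^b`
  on units, and EVERY even primitive `ψ : DirichletCharacter (PadicAlgCl 2) (2^k)`:
  `(Σ_{b ∈ (ℤ/2^k)ˣ} ψ⁻¹(b) · τ_b • e(x_{k,∅})) · gaussSum ψ (zmodChar (2^k) ζ_{2^k}) = q · ratTwistedSymbolSum f ψ · R⁻(ψ)` in `ℚ̄₂`.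
* **`sum_smul_eq_two_trivial`**: the trivial-character twin `Σ_{b ∈ (ℤ/2^k)ˣ} τ_b • e(x_{k,∅}) = q · P_2(2⁻¹) · [0]⁺ · R⁻_𝟙` (as `algebraMap ℚ ℚ̄₂`).

References: [Kato2004Asterisque] Thm. 6.6 (1) (p. 163), Thm. 9.7 (p. 189), (5.7.1); [MazurTateTeitelbaum1986Invent] §I.8 (8.6); [Kobayashi2003] Prop. 8.25.
-/

set_option autoImplicit false
-- the Theorems namespace of this sub repeats the summit name by design (D-0017 nested layout)
set_option linter.dupNamespace false
-- `IsCyclotomicExtension {m} ℚ (CyclotomicField m ℚ)` through `NeZero ((m : ℕ) : ℚ)` (as in `EulerSystemValues.sigma`)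
set_option backward.isDefEq.respectTransparency false

noncomputable section

open scoped BigOperators NumberField TensorProduct MatrixGroups Real

open CongruenceSubgroup Complex WeierstrassCurve IsDedekindDomain Polynomial
  Literature.NumberTheory.GaloisRepresentations
  Literature.NumberTheory.EllipticCurves Literature.NumberTheory.EllipticCurves.ModularForms
  Literature.NumberTheory.EllipticCurves.Kato2004 Literature.NumberTheory.EllipticCurves.Kato2004.EulerSystemValues
  Summit.BirchSwinnertonDyer.Rank1Residual.Additive
  Summit.BirchSwinnertonDyer.BirchSwinnertonDyer.Theorems.SignedKatoOffTwo.HondaLog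

namespace Summit.BirchSwinnertonDyer.BirchSwinnertonDyer.Theorems.SignedKatoOffTwo.KatoValue

variable {W : WeierstrassCurve ℚ} [W.IsElliptic] {N : ℕ} [NeZero N] {f : CuspForm (Gamma0 N) 2}

/-! ## §0 Two more equal-modulus re-indexings (the `cast` on the summand side) -/

/-- `Σ_{b ∈ (ℤ/m₂)ˣ} G(cast b) = Σ_{b ∈ (ℤ/m₁)ˣ} G(b)` along `m₁ = m₂`. [folklore] -/
theorem sum_units_cast_of_eq {R : Type*} [AddCommMonoid R] {m₁ m₂ : ℕ} [NeZero m₁] [NeZero m₂] (h : m₁ = m₂)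
    (G : ZMod m₁ → R) : ∑ b : (ZMod m₂)ˣ, G (ZMod.cast (b : ZMod m₂) : ZMod m₁) = ∑ b : (ZMod m₁)ˣ, G (b : ZMod m₁) := by
  subst h; simp only [ZMod.cast_id]

/-- `Σ_{b ∈ (ℤ/m₂)ˣ} χ'⁻¹(b)·G(cast b) = Σ_{b ∈ (ℤ/m₁)ˣ} χ⁻¹(b)·G(b)` along `m₁ = m₂`, `χ' = changeLevel (dvd_of_eq h) χ`. [folklore] -/
theorem sum_units_inv_mul_cast_changeLevel_of_eq {R : Type*} [CommRing R] {m₁ m₂ : ℕ} [NeZero m₁] [NeZero m₂] (h : m₁ = m₂)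
    (χ : DirichletCharacter R m₁) (G : ZMod m₁ → R) :
    ∑ b : (ZMod m₂)ˣ, (DirichletCharacter.changeLevel (dvd_of_eq h) χ)⁻¹ (b : ZMod m₂) * G (ZMod.cast (b : ZMod m₂) : ZMod m₁) =
      ∑ b : (ZMod m₁)ˣ, χ⁻¹ (b : ZMod m₁) * G (b : ZMod m₁) := by
  subst h; simp only [DirichletCharacter.changeLevel_self, ZMod.cast_id]


/-- **Kato's value law × Birch at `2`, in the socket's currency (modulus `2^k`, `ℚ̄₂`-valued characters).** See the module docstring.
Proof: transport `ψ` to modulus `cycLevel 2 k ∅` (`changeLevel` along `2^k = cycLevel 2 k ∅`), descend it to `ℚ(ζ)` along `e`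
(`exists_ringHomComp_eq_two`), apply `charSum_smul_mul_gaussSum_eq_padic` with `τ ∘ cast`, and transport the three character-dependent
factors back (`sum_units_inv_mul_changeLevel_of_eq`, `gaussSum_changeLevel_zmodChar_of_eq`, `ratTwistedSymbolSum_changeLevel_of_eq`,
`changeLevel_of_eq_apply_intCast`). CONDITIONAL on the `ZetaBody` witness.
[cite: Kato2004Asterisque, Thm. 6.6 (1) (p. 163), Thm. 9.7 (p. 189)] [cite: MazurTateTeitelbaum1986Invent, §I.8 (8.6)] -/
theorem charSum_smul_mul_gaussSum_eq_two (hf : IsNewformOf W f)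
    [ContinuousSMul ℤ_[2] (W.tateModule 2)] [Module.Free ℤ_[2] (W.tateModule 2)] [Module.Finite ℤ_[2] (W.tateModule 2)]
    {ι : (m : ℕ) → (CyclotomicField m ℚ →+* ℂ)} {κ : ℝ}
    {Λ : ∀ (k : ℕ) (r : Finset (HeightOneSpectrum (𝓞 ℚ))),
      H1 (tateRep W 2) (cycSubgroup 2 k r) →ₗ[ℤ_[2]] ℚ_[2] ⊗[ℚ] CyclotomicField (cycLevel 2 k r) ℚ}
    {c d a : ℤ} {A : ℕ}
    {z : ∀ (k : ℕ) (r : (cyclotomicLevelsRat 2 (badPlaces c d A N)).Ideals),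
      H1 (tateRep W 2) ((cyclotomicLevelsRat 2 (badPlaces c d A N)).level k r.1)}
    {x : ∀ (k : ℕ) (r : (cyclotomicLevelsRat 2 (badPlaces c d A N)).Ideals),
      CyclotomicField (cycLevel 2 k r.1) ℚ}
    (hbody : ZetaBody W 2 f ι κ Λ c d a A z x) {q : ℚ} (hκ : κ = q)
    {k e : ℕ} (hk : 1 ≤ k) (hA : A = 2 ^ e) (d' : ℤ)
    (hcd : Int.gcd (c * d) (cycLevel 2 k (∅ : Finset (HeightOneSpectrum (𝓞 ℚ))) * A) = 1)
    (hdd' : d * d' ≡ 1 [ZMOD (A : ℤ)])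
    (hι : ι (cycLevel 2 k (∅ : Finset (HeightOneSpectrum (𝓞 ℚ))))
        (IsCyclotomicExtension.zeta (cycLevel 2 k (∅ : Finset (HeightOneSpectrum (𝓞 ℚ)))) ℚ
          (CyclotomicField (cycLevel 2 k (∅ : Finset (HeightOneSpectrum (𝓞 ℚ)))) ℚ)) =
      Complex.exp (2 * π * I / (cycLevel 2 k (∅ : Finset (HeightOneSpectrum (𝓞 ℚ))) : ℕ)))
    (eP : CyclotomicField (cycLevel 2 k (∅ : Finset (HeightOneSpectrum (𝓞 ℚ)))) ℚ →+* PadicAlgCl 2)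
    (heP : eP (IsCyclotomicExtension.zeta (cycLevel 2 k (∅ : Finset (HeightOneSpectrum (𝓞 ℚ)))) ℚ
          (CyclotomicField (cycLevel 2 k (∅ : Finset (HeightOneSpectrum (𝓞 ℚ)))) ℚ)) = PadicCyclotomicTower.zeta 2 k)
    [NeZero (2 ^ k)] (τ : ZMod (2 ^ k) → Field.absoluteGaloisGroup ℚ_[2])
    (hτ : ∀ b : ZMod (2 ^ k), IsUnit b → τ b • PadicCyclotomicTower.zeta 2 k = PadicCyclotomicTower.zeta 2 k ^ b.val)
    (ψ : DirichletCharacter (PadicAlgCl 2) (2 ^ k)) (hψ : ψ.IsPrimitive) (hev : ψ.Even) :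
    (∑ b : (ZMod (2 ^ k))ˣ, ψ⁻¹ (b : ZMod (2 ^ k)) * τ (b : ZMod (2 ^ k)) •
        eP (x k (cyclotomicLevelsRat 2 (badPlaces c d A N)).idealOne)) *
      gaussSum ψ (AddChar.zmodChar (2 ^ k) (zeta_pow_prime_pow_self (p := 2) k)) =
    algebraMap ℚ (PadicAlgCl 2) q * ratTwistedSymbolSum f ψ *
      (((c : PadicAlgCl 2) ^ 2 * (d : PadicAlgCl 2) ^ 2) * ((ratMinusSymbol f ((a : ℚ) / A) : ℚ) : PadicAlgCl 2) -
          ((c : PadicAlgCl 2) * (d : PadicAlgCl 2) ^ 2) * ψ ((c : ℤ) : ZMod (2 ^ k)) *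
            ((ratMinusSymbol f ((a * c : ℚ) / A) : ℚ) : PadicAlgCl 2) -
          ((c : PadicAlgCl 2) ^ 2 * (d : PadicAlgCl 2)) * ψ ((d : ℤ) : ZMod (2 ^ k)) *
            ((ratMinusSymbol f ((a * d' : ℚ) / A) : ℚ) : PadicAlgCl 2) +
          ((c : PadicAlgCl 2) * (d : PadicAlgCl 2)) * ψ ((c * d : ℤ) : ZMod (2 ^ k)) *
            ((ratMinusSymbol f ((a * c * d' : ℚ) / A) : ℚ) : PadicAlgCl 2)) := by
  -- the one equality of moduli
  have hm : cycLevel 2 k (∅ : Finset (HeightOneSpectrum (𝓞 ℚ))) = 2 ^ k := cycLevel_empty_eq 2 k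
  have h : 2 ^ k = cycLevel 2 k (∅ : Finset (HeightOneSpectrum (𝓞 ℚ))) := hm.symm
  -- transport `ψ` to modulus `cycLevel 2 k ∅` and descend it along `e`
  set ψ' : DirichletCharacter (PadicAlgCl 2) (cycLevel 2 k (∅ : Finset (HeightOneSpectrum (𝓞 ℚ)))) :=
    DirichletCharacter.changeLevel (dvd_of_eq h) ψ with hψ'
  obtain ⟨ψF, hψF⟩ := exists_ringHomComp_eq_two hm eP heP ψ'
  have hψFprim : ψF.IsPrimitive := by
    rw [← isPrimitive_ringHomComp_iff eP ψF, hψF, hψ', isPrimitive_changeLevel_of_eq h ψ]; exact hψ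
  have hψFeven : ψF.Even := by
    rw [← even_ringHomComp_iff eP ψF, hψF, hψ', even_changeLevel_of_eq h ψ]; exact hev
  -- the family `τ ∘ cast` at modulus `cycLevel 2 k ∅`
  have hz : PadicCyclotomicTower.zeta 2 k ^ cycLevel 2 k (∅ : Finset (HeightOneSpectrum (𝓞 ℚ))) = 1 := padicZeta_pow_eq_one hm
  have hτ' : ∀ b : ZMod (cycLevel 2 k (∅ : Finset (HeightOneSpectrum (𝓞 ℚ)))), IsUnit b →
      τ (ZMod.cast b : ZMod (2 ^ k)) • PadicCyclotomicTower.zeta 2 k = PadicCyclotomicTower.zeta 2 k ^ b.val := by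
    intro b hb
    have hb' : IsUnit (ZMod.cast b : ZMod (2 ^ k)) := by
      have := hb.map (ZMod.castHom (dvd_of_eq h) (ZMod (2 ^ k)))
      simpa using this
    rw [hτ _ hb', val_cast_of_eq hm]
  -- B2 along `e` at modulus `cycLevel 2 k ∅`
  have hD3 := charSum_smul_mul_gaussSum_eq_padic hf 2 hbody hκ hk hA d' hcd hdd' hι eP heP hz
    (fun b ↦ τ (ZMod.cast b : ZMod (2 ^ k))) hτ' ψF hψFprim hψFeven
  rw [hψF, hψ'] at hD3
  -- transport every factor back to modulus `2^k`
  rw [sum_units_inv_mul_cast_changeLevel_of_eq h ψ (fun b ↦ τ b • eP (x k (cyclotomicLevelsRat 2 (badPlaces c d A N)).idealOne)),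
    gaussSum_changeLevel_zmodChar_of_eq h ψ (zeta_pow_prime_pow_self (p := 2) k) hz,
    ratTwistedSymbolSum_changeLevel_of_eq f h ψ, changeLevel_of_eq_apply_intCast h ψ, changeLevel_of_eq_apply_intCast h ψ,
    changeLevel_of_eq_apply_intCast h ψ] at hD3
  exact hD3

/-- **The trivial-character twin in the socket's currency**: `Σ_{b ∈ (ℤ/2^k)ˣ} τ_b • e(x_{k,∅}) = q · P_2(2⁻¹) · [0]⁺_f · R⁻_𝟙`
(`KatoValue.sum_sigma_eq_of_zetaBody` along `e`, `e ∘ σ_b = τ_b • e`, modulus moved from `cycLevel 2 k ∅` to `2^k`).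
CONDITIONAL on the `ZetaBody` witness. [cite: Kato2004Asterisque, Thm. 6.6 (1) (p. 163), Thm. 9.7 (p. 189)] -/
theorem sum_smul_eq_two_trivial (hf : IsNewformOf W f)
    [ContinuousSMul ℤ_[2] (W.tateModule 2)] [Module.Free ℤ_[2] (W.tateModule 2)] [Module.Finite ℤ_[2] (W.tateModule 2)]
    {ι : (m : ℕ) → (CyclotomicField m ℚ →+* ℂ)} {κ : ℝ}
    {Λ : ∀ (k : ℕ) (r : Finset (HeightOneSpectrum (𝓞 ℚ))),
      H1 (tateRep W 2) (cycSubgroup 2 k r) →ₗ[ℤ_[2]] ℚ_[2] ⊗[ℚ] CyclotomicField (cycLevel 2 k r) ℚ}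
    {c d a : ℤ} {A : ℕ}
    {z : ∀ (k : ℕ) (r : (cyclotomicLevelsRat 2 (badPlaces c d A N)).Ideals),
      H1 (tateRep W 2) ((cyclotomicLevelsRat 2 (badPlaces c d A N)).level k r.1)}
    {x : ∀ (k : ℕ) (r : (cyclotomicLevelsRat 2 (badPlaces c d A N)).Ideals),
      CyclotomicField (cycLevel 2 k r.1) ℚ}
    (hbody : ZetaBody W 2 f ι κ Λ c d a A z x) {q : ℚ} (hκ : κ = q)
    {k e : ℕ} (hk : 1 ≤ k) (hA : A = 2 ^ e) (d' : ℤ)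
    (hcd : Int.gcd (c * d) (cycLevel 2 k (∅ : Finset (HeightOneSpectrum (𝓞 ℚ))) * A) = 1)
    (hdd' : d * d' ≡ 1 [ZMOD (A : ℤ)])
    (eP : CyclotomicField (cycLevel 2 k (∅ : Finset (HeightOneSpectrum (𝓞 ℚ)))) ℚ →+* PadicAlgCl 2)
    (heP : eP (IsCyclotomicExtension.zeta (cycLevel 2 k (∅ : Finset (HeightOneSpectrum (𝓞 ℚ)))) ℚ
          (CyclotomicField (cycLevel 2 k (∅ : Finset (HeightOneSpectrum (𝓞 ℚ)))) ℚ)) = PadicCyclotomicTower.zeta 2 k)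
    [NeZero (2 ^ k)] (τ : ZMod (2 ^ k) → Field.absoluteGaloisGroup ℚ_[2])
    (hτ : ∀ b : ZMod (2 ^ k), IsUnit b → τ b • PadicCyclotomicTower.zeta 2 k = PadicCyclotomicTower.zeta 2 k ^ b.val) :
    ∑ b : (ZMod (2 ^ k))ˣ, τ (b : ZMod (2 ^ k)) • eP (x k (cyclotomicLevelsRat 2 (badPlaces c d A N)).idealOne) =
      algebraMap ℚ (PadicAlgCl 2) (q * eulerFactorAtOne W N 2 * ratPlusSymbol f 0 * ratCuspFactor f true c d a A d') := by
  have hm : cycLevel 2 k (∅ : Finset (HeightOneSpectrum (𝓞 ℚ))) = 2 ^ k := cycLevel_empty_eq 2 k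
  have h : 2 ^ k = cycLevel 2 k (∅ : Finset (HeightOneSpectrum (𝓞 ℚ))) := hm.symm
  have hB4c := sum_sigma_eq_of_zetaBody hf 2 hbody hκ hk hA d' hcd hdd'
  have himg := congrArg eP hB4c
  rw [map_sum, RingHom.map_rat_algebraMap] at himg
  rw [← himg]
  -- `e(σ_b x) = τ_{cast b} • e(x)` and re-index along `2^k = cycLevel 2 k ∅` with the trivial character
  have hτ' : ∀ b : ZMod (cycLevel 2 k (∅ : Finset (HeightOneSpectrum (𝓞 ℚ)))), IsUnit b →
      τ (ZMod.cast b : ZMod (2 ^ k)) • PadicCyclotomicTower.zeta 2 k = PadicCyclotomicTower.zeta 2 k ^ b.val := by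
    intro b hb
    have hb' : IsUnit (ZMod.cast b : ZMod (2 ^ k)) := by
      have := hb.map (ZMod.castHom (dvd_of_eq h) (ZMod (2 ^ k)))
      simpa using this
    rw [hτ _ hb', val_cast_of_eq hm]
  rw [← sum_units_cast_of_eq h (fun b ↦ τ b • eP (x k (cyclotomicLevelsRat 2 (badPlaces c d A N)).idealOne))]
  refine Finset.sum_congr rfl fun b _ ↦ ?_
  exact (map_sigma_eq_smul eP heP _ b
    (hτ' ((b : (ZMod (cycLevel 2 k (∅ : Finset (HeightOneSpectrum (𝓞 ℚ)))))ˣ) : ZMod _) (Units.isUnit b)) _).symm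

end Summit.BirchSwinnertonDyer.BirchSwinnertonDyer.Theorems.SignedKatoOffTwo.KatoValue

end
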